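import Summits.CriticalPhenomena.PercolationContinuityZ3.Theorems.Transplant.TwoAxisParaCellsFineFrame
import Summits.CriticalPhenomena.PercolationContinuityZ3.Theorems.Transplant.TwoAxisParaCellsFineRepQ
import Summits.CriticalPhenomena.PercolationContinuityZ3.Theorems.Transplant.TwoAxisParaCellsFineQ
import HarnessLib

/-!
# WAVE-Q binder row Q43 «TwoAxisParaCellsFineFrame» ↦ «TwoAxisParaCellsFineFrameQ» (quasi-step rung (N3-b); table v0.7 level L3; captain/pen gen-1 g4): weak steps of the cell map, `3M`-quasi-steps of the frame, reference vertices at radius `M·‖rep₂ z‖₁` under (ι) := `Skelφ.QStepsN G φ M`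

builds on p205010 (kernel theorem, internal audit signed; external expert review pending) — nothing in this file uses p205010; nothing here is a claim about any open node; no carrier,
no node, no definition.  Lane `prim-bschramm`, seat `prim-bschramm-gen-1` (gen 4).  Helper file (`--supports stmt-CriticalPhenomena-4575 --as helper`).
Ported (the in-cone declarations of «TwoAxisParaCellsFineFrame» that take the step hypothesis `(hstep : Steps G φ)`): `weakSteps_ψ_q`, `qStepsN_frame_q`, `exists_vertex_ψ_eq_q` — binder
`(hstep : Steps G φ) ↦ {M : ℕ} (hq : Skelφ.QStepsN G φ M)` (hunk (i)), LEVEL-0/lower-row calls swapped for their Q twins (hunk (ii)), graph-ball radii / window floors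
multiplied by the cost `M` (hunk (iv)); every other binder and every proof line byte-identical; step-free residents of the module are imported, not copied.
Floor row (p5-g28 reads): `exists_vertex_ψ_eq_q` radius slot `‖rep₂ z‖₁ ≤ R ↦ M·‖rep₂ z‖₁ ≤ R`; cost token of `qStepsN_frame_q`: `3 * M` (row Q21).
-/

namespace Summit.CriticalPhenomena.PercolationContinuityZ3.Theorems.Transplant

open Literature.Probability.LatticeModels

namespace Skelφ

open Literature.Probability.Percolation.KozmaNitzan.Cells (oth oth_ne eq_oth_of_ne oth_oth)
open Literature.Barriers.CriticalPhenomena (graphBall mem_graphBall_self graphBall_mono)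
open TwoAxis.Para (coarse lam0 lam1 modulus detD rep₂)

variable {V : Type} {G : SimpleGraph V} {φ : V → Site 2}

namespace FinePrm

variable (pr : FinePrm)

/-- **The cell map has weak steps** (from `QStepsN` of `φ`). [this work] -/
theorem weakSteps_ψ_q {M : ℕ} (hq : QStepsN G φ M) (t : V) (hc₀ : 0 ≤ pr.c₀) (hc₁ : 0 ≤ pr.c₁) (hD : 0 < pr.D) : WeakSteps G (pr.ψ φ t) :=
  weakSteps_fineSkel_of_qStepsN hq t hD hc₀ hc₁

/-- **The frame has `3M`-quasi-steps** (under `QStepsN G φ M`) for the raw axis of record `b = argmax |lvGen I ·|`: `|lvGen I (oth b)| ≤ |lvGen I b| ≠ 0`, `0 < c_I`, `A ≠ 0`,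
`c_I·L_I ≤ D ≤ 3·c_I·|A|·|lvGen I b|`. [this work] -/
theorem qStepsN_frame_q {M : ℕ} (hq : QStepsN G φ M) (t : V) (I b : Fin 2) (hc : 0 < pr.cOf I) (hA : pr.A ≠ 0) (hD : 0 < pr.D)
    (hL : pr.cOf I * pr.L I ≤ pr.D) (hb : |pr.lvGen I (oth b)| ≤ |pr.lvGen I b|) (hnz : pr.lvGen I b ≠ 0)
    (hU3 : pr.D ≤ 3 * (pr.cOf I * |pr.A| * |pr.lvGen I b|)) : QStepsN G (pr.frame φ t I b) (3 * M) := by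
  have hA' : 0 < |pr.A| := abs_pos.2 hA
  obtain rfl | rfl : I = 0 ∨ I = 1 := by fin_cases I <;> simp
  · rw [cOf_zero] at hc hU3; rw [cOf_zero, L_zero] at hL
    have hcf := abs_coef_v pr.c₀ pr.A pr.vα pr.vβ hc.le
    have key : ∀ k : Fin 2, |coef (pr.c₀ * pr.A * pr.vβ) (-(pr.c₀ * pr.A * pr.vα)) k| = pr.c₀ * |pr.A| * |pr.lvGen 0 (oth k)| := by
      intro k; obtain rfl | rfl : k = 0 ∨ k = 1 := by fin_cases k <;> simp
      · rw [hcf.1, show oth (0 : Fin 2) = 1 from rfl, lvGen_zero_one]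
      · rw [hcf.2, show oth (1 : Fin 2) = 0 from rfl, lvGen_zero_zero]
    rw [frame_zero]
    refine qStepsN_vFrame_q hq t hc.le hD (by rwa [add_comm]) ?_ ?_ ?_
    · rw [key, key, oth_oth]; exact mul_le_mul_of_nonneg_left hb (by positivity)
    · rw [key, oth_oth]; exact mul_pos (mul_pos hc hA') (abs_pos.2 hnz)
    · rw [key, oth_oth]; exact hU3
  · rw [cOf_one] at hc hU3; rw [cOf_one, L_one] at hL
    have hcf := abs_coef_u pr.c₁ pr.A pr.n pr.h hc.le
    have key : ∀ k : Fin 2, |coef (-(pr.c₁ * pr.A * pr.h)) (pr.c₁ * pr.A * pr.n) k| = pr.c₁ * |pr.A| * |pr.lvGen 1 (oth k)| := by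
      intro k; obtain rfl | rfl : k = 0 ∨ k = 1 := by fin_cases k <;> simp
      · rw [hcf.1, show oth (0 : Fin 2) = 1 from rfl, lvGen_one_one]
      · rw [hcf.2, show oth (1 : Fin 2) = 0 from rfl, lvGen_one_zero]
    rw [frame_one]
    refine qStepsN_uFrame_q hq t hc.le hD hL ?_ ?_ ?_
    · rw [key, key, oth_oth]; exact mul_le_mul_of_nonneg_left hb (by positivity)
    · rw [key, oth_oth]; exact mul_pos (mul_pos hc hA') (abs_pos.2 hnz)
    · rw [key, oth_oth]; exact hU3

/-- **A vertex with prescribed cell point** `z` lies within graph distance `M·‖rep₂ z‖₁` of `t` (from `QStepsN G φ M`; `D = detD`, `c_I·L_I + 2 ≤ D`).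
[cite: KozmaNitzan2024, §4 p. 26 ((29))] -/
theorem exists_vertex_ψ_eq_q {M : ℕ} (hq : QStepsN G φ M) (t : V) (hc₀ : 0 < pr.c₀) (hc₁ : 0 < pr.c₁) (hDd : pr.D = detD pr.A pr.n pr.h pr.vα pr.vβ)
    (hD : 0 < pr.D) (hL0 : pr.c₀ * pr.L 0 + 2 ≤ pr.D) (hL1 : pr.c₁ * pr.L 1 + 2 ≤ pr.D) (z : Site 2) {R : ℕ}
    (hR : M * ((rep₂ pr.A pr.n pr.h pr.vα pr.vβ pr.c₀ pr.c₁ z 0).natAbs + (rep₂ pr.A pr.n pr.h pr.vα pr.vβ pr.c₀ pr.c₁ z 1).natAbs) ≤ R) :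
    ∃ y ∈ graphBall G t R, pr.ψ φ t y = z := by
  rw [L_zero, add_comm |pr.vα|] at hL0; rw [L_one] at hL1
  rw [hDd] at hD hL0 hL1
  obtain ⟨g, hg, hgz⟩ := exists_mem_graphBall_fineSkel_eq_q hq t hc₀ hc₁ hD hL0 hL1 z
  exact ⟨g, graphBall_mono G t hR hg, by rw [ψ, hDd]; exact hgz⟩

end FinePrm

end Skelφ

end Summit.CriticalPhenomena.PercolationContinuityZ3.Theorems.Transplant
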